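import Literature.NumberTheory.Automorphic.HilbertRepIsotypicBlockTrace      -- ★ H2 (p838187): `IsotypicBlock.hasSum_inner_apply_of_apply_eq_sum_smul`, `orthonormal_block`, `ContRepresentation.adjoint_apply_copy`
import Literature.Analysis.OperatorTheory.NuclearAlongHilbertBasis             -- ★ `tsum_inner_apply_self_eq_of_summable_norm_apply`, `summable_inner_apply_self_of_summable_norm_apply`
import Mathlib.Analysis.InnerProductSpace.l2Space
import Mathlib.Analysis.InnerProductSpace.Adjoint
import Mathlib.Topology.Algebra.InfiniteSum.Real
import HarnessLib

/-!
# The trace on an isotypic block read along ANY Hilbert basis of the ambient closed subspace: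
# nuclearity of the block operator (`Σ_k ⟪b_k, C b_k⟫ = tr(β) · Σ_l ⟪e_l, T e_l⟫` for every Hilbert basis `b` of `W`)

Topic `NumberTheory/Automorphic`; namespace `Literature.NumberTheory.Automorphic.IsotypicBlock` (continuation of ★ `HilbertRepIsotypicBlockTrace`,
the road «TF» brick H2).  THEOREMS ONLY (no definition, no instance, no notation, no named fact, no `sorry`).  Cell `hodgecm-mathlib`, programme P3
«U3-mult», ROAD «TF» (letter #84, residual `ArchFinTraceSplit`), assembler J2: the `hanis`-FREE replacement of the pair (B-TF1 basis-freeness on `π′` via the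
anisotropic smooth trace expansion) + (H1 block reduction), for the TF pay-down line whose head quantifies over ALL Hermitian data.

THE SETTING ([ReedSimon1972, Thm. VI.18, VI.24]; [DeitmarEchterhoff2014, §7.3 Thm. 7.3.2, Lemma 9.2.7]; [Gelbart1975, (10.12)–(10.14)]).  `E`, `V` complex Hilbert
spaces, `W ≤ E` a CLOSED subspace (`[CompleteSpace W]`), `U : m → (V →ₗᵢ[ℂ] E)` a FINITE family of isometries with pairwise ORTHOGONAL ranges INSIDE `W` («`|m|`
orthogonal copies of `V` in `W`», the block `⨆_i range U_i`), a bounded `T` on `V` that is NUCLEAR ALONG ONE HILBERT BASIS `e` of `V` (`Σ_l ‖T e_l‖ < ∞` — the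
currency of ★ `NuclearAlongHilbertBasis`, delivered for archimedean integrated operators by ★ `ArchIntegratedOperatorNuclearOfKTypeGrowth`), and a bounded `C` on `E`
which (i) acts on the copies through a matrix `β` and `T` — `C (U_j v) = Σ_i β_{ij} U_i (T v)` — and (ii) KILLS every vector of `W` orthogonal to all the copies.
THEN (`tsum_inner_apply_eq_trace_mul_of_summable_norm_apply`): along EVERY Hilbert basis `b` of `W` the diagonal series `k ↦ ⟪b_k, C b_k⟫` is summable and
`Σ_k ⟪b_k, C b_k⟫ = tr(β) · Σ_l ⟪e_l, T e_l⟫`.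
Proof: `C` maps `W` into `W` (§1: `C w = Σ_{i,j} β_{ij} U_i T U_j^* w` on `W`); the restricted operator `C|_W` is nuclear along the ASSEMBLED Hilbert basis of `W` made of
the block family `(j, l) ↦ U_j e_l` (★ `orthonormal_block`) and any Hilbert basis of the complement `{x ∈ W | x ⟂ every range U_i}` (§2), because
`‖C (U_j e_l)‖ ≤ (Σ_{i,j} |β_{ij}|) ‖T e_l‖` and `C` vanishes on the complement (§3); so ★ `tsum_inner_apply_self_eq_of_summable_norm_apply` makes the diagonal sum basis-free
on `W`, and along the assembled basis it is the block sum of ★ H2 `hasSum_inner_apply_of_apply_eq_sum_smul` plus zero (§4).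
This is the operator-theoretic content of «`tr π′(f_∞ ⊗ Λ) = Θ_{π′_∞}(f_∞) · tr σ(Λ)|σ^{K′}`» read on the IRREDUCIBLE `π′ ⊂ L²` itself rather than on its `K′`-fixed block
[BorelJacquet1979, §4.6; Gelbart1975, (10.14)], with no compactness of the quotient.  HONEST LABEL: generic; HC_CM is proved only modulo the printed citations until rung 0
closes, and this file moves no count.

## References
* M. Reed, B. Simon, *Methods of Modern Mathematical Physics I* (1972), Thm. II.6, Thm. VI.18, Thm. VI.24 [ReedSimon1972].
* A. Deitmar, S. Echterhoff, *Principles of Harmonic Analysis*, 2nd ed. (2014), §7.3 Thm. 7.3.2, Lemma 9.2.7 [DeitmarEchterhoff2014].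
* S. Gelbart, *Automorphic Forms on Adele Groups* (1975), (10.12)–(10.14) [Gelbart1975].
* A. Borel, H. Jacquet, *Automorphic forms and automorphic representations*, PSPM 33.1 (1979), §4.6 [BorelJacquet1979].
-/

set_option autoImplicit false

noncomputable section

open scoped InnerProductSpace
open Filter Submodule

namespace Literature.NumberTheory.Automorphic

namespace IsotypicBlock

open Literature.Analysis.OperatorTheory

universe u

variable {V : Type*} {E : Type u} [NormedAddCommGroup V] [InnerProductSpace ℂ V] [CompleteSpace V]
  [NormedAddCommGroup E] [InnerProductSpace ℂ E] [CompleteSpace E]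
  {m : Type*} [Fintype m] [DecidableEq m]

/-! ## §1 The block projection `w ↦ Σ_i U_i U_i^* w` and the shape of `C` on `W` -/

omit [DecidableEq m] in
/-- **`w − Σ_i U_i U_i^* w` is orthogonal to every copy**: `⟪U_i v, w − Σ_j U_j U_j^* w⟫ = 0` (orthogonal ranges: only `j = i` survives, and `⟪U_i v, U_i U_i^* w⟫ = ⟪v, U_i^* w⟫
= ⟪U_i v, w⟫`). [cite: DeitmarEchterhoff2014, §7.3 Thm. 7.3.2] [cite: ReedSimon1972, Thm. II.6] -/
theorem inner_copy_sub_sum_adjoint (U : m → (V →ₗᵢ[ℂ] E)) (hU : ∀ i j, i ≠ j → ∀ v w, ⟪U i v, U j w⟫_ℂ = 0) (i : m) (v : V) (w : E) :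
    ⟪U i v, w - ∑ j, U j (ContinuousLinearMap.adjoint (U j).toContinuousLinearMap w)⟫_ℂ = 0 := by
  rw [inner_sub_right, inner_sum, Finset.sum_eq_single i]
  · rw [LinearIsometry.inner_map_map, ← LinearIsometry.coe_toContinuousLinearMap, ContinuousLinearMap.adjoint_inner_right,
      LinearIsometry.coe_toContinuousLinearMap, sub_self]
  · intro j _ hji
    exact hU i j (Ne.symm hji) _ _
  · intro hi
    exact absurd (Finset.mem_univ i) hi

omit [DecidableEq m] in
/-- **The shape of `C` on `W`**: if `C (U_j v) = Σ_i β_{ij} U_i (T v)` and `C` kills the vectors of `W` orthogonal to all copies (the copies lying in `W`), then for `w ∈ W`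
`C w = Σ_j Σ_i β_{ij} U_i (T (U_j^* w))` — apply `C` to `w = Σ_j U_j U_j^* w + (w − Σ_j U_j U_j^* w)`. [cite: DeitmarEchterhoff2014, §7.3 Thm. 7.3.2] [cite: Gelbart1975, (10.14)] -/
theorem apply_eq_sum_of_mem (W : Submodule ℂ E) (U : m → (V →ₗᵢ[ℂ] E)) (hU : ∀ i j, i ≠ j → ∀ v w, ⟪U i v, U j w⟫_ℂ = 0)
    (hUW : ∀ i v, U i v ∈ W) (T : V →L[ℂ] V) (C : E →L[ℂ] E) (β : Matrix m m ℂ)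
    (hC : ∀ j v, C (U j v) = ∑ i, β i j • U i (T v)) (hC0 : ∀ w ∈ W, (∀ i v, ⟪U i v, w⟫_ℂ = 0) → C w = 0) {w : E} (hw : w ∈ W) :
    C w = ∑ j, ∑ i, β i j • U i (T (ContinuousLinearMap.adjoint (U j).toContinuousLinearMap w)) := by
  set p : E := ∑ j, U j (ContinuousLinearMap.adjoint (U j).toContinuousLinearMap w) with hp
  have hpW : p ∈ W := W.sum_mem fun j _ => hUW j _
  have h0 : C (w - p) = 0 := hC0 (w - p) (W.sub_mem hw hpW) fun i v => inner_copy_sub_sum_adjoint U hU i v w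
  have h1 : C w = C p := by
    rw [← sub_eq_zero, ← map_sub, h0]
  rw [h1, hp, map_sum]
  exact Finset.sum_congr rfl fun j _ => hC j _

omit [DecidableEq m] in
/-- `C` maps `W` into `W`. [cite: DeitmarEchterhoff2014, §7.3 Thm. 7.3.2] -/
theorem apply_mem_of_mem (W : Submodule ℂ E) (U : m → (V →ₗᵢ[ℂ] E)) (hU : ∀ i j, i ≠ j → ∀ v w, ⟪U i v, U j w⟫_ℂ = 0)
    (hUW : ∀ i v, U i v ∈ W) (T : V →L[ℂ] V) (C : E →L[ℂ] E) (β : Matrix m m ℂ)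
    (hC : ∀ j v, C (U j v) = ∑ i, β i j • U i (T v)) (hC0 : ∀ w ∈ W, (∀ i v, ⟪U i v, w⟫_ℂ = 0) → C w = 0) {w : E} (hw : w ∈ W) :
    C w ∈ W := by
  rw [apply_eq_sum_of_mem W U hU hUW T C β hC hC0 hw]
  exact W.sum_mem fun j _ => W.sum_mem fun i _ => W.smul_mem _ (hUW i _)

omit [CompleteSpace V] [CompleteSpace E] [DecidableEq m] in
/-- **Norm bound on the copies**: `‖C (U_j v)‖ ≤ (Σ_i ‖β_{ij}‖) · ‖T v‖`. [cite: ReedSimon1972, Thm. VI.24] -/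
theorem norm_apply_copy_le (U : m → (V →ₗᵢ[ℂ] E)) (T : V →L[ℂ] V) (C : E →L[ℂ] E) (β : Matrix m m ℂ)
    (hC : ∀ j v, C (U j v) = ∑ i, β i j • U i (T v)) (j : m) (v : V) :
    ‖C (U j v)‖ ≤ (∑ i, ‖β i j‖) * ‖T v‖ := by
  rw [hC, Finset.sum_mul]
  refine (norm_sum_le _ _).trans (Finset.sum_le_sum fun i _ => ?_)
  rw [norm_smul, LinearIsometry.norm_map]

/-! ## §2 The complement of the copies inside `W` and the assembled Hilbert basis of `W` -/

omit [Fintype m] in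
/-- **The assembled Hilbert basis of `W`.**  For a Hilbert basis `e` of `V`, copies `U_i` with orthogonal ranges inside the closed `W`, there are an index type `κ'`, an
orthonormal-complement family `g : κ' → W` with `⟪U_i v, g c⟫ = 0`, and a HILBERT BASIS of `W` indexed by `(m × κ) ⊕ κ'` whose `inl (j, l)` vectors are `U_j e_l` and whose
`inr c` vectors are `g c` (Mathlib `HilbertBasis.mkOfOrthogonalEqBot`: a vector of `W` orthogonal to every `U_j e_l` has `U_j^* x ⟂ e_l` for all `l`, so `U_j^* x = 0`, so
`x ⟂ range U_j`, so `x` lies in the complement, where it is orthogonal to a Hilbert basis). [cite: ReedSimon1972, Thm. II.6] [cite: DeitmarEchterhoff2014, §7.3 Thm. 7.3.2] -/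
theorem exists_hilbertBasis_sum (W : Submodule ℂ E) [CompleteSpace W] {κ : Type*} (e : HilbertBasis κ ℂ V)
    (U : m → (V →ₗᵢ[ℂ] E)) (hU : ∀ i j, i ≠ j → ∀ v w, ⟪U i v, U j w⟫_ℂ = 0) (hUW : ∀ i v, U i v ∈ W) :
    ∃ (κ' : Type u) (g : κ' → W) (b : HilbertBasis ((m × κ) ⊕ κ') ℂ W),
      (∀ c i v, ⟪U i v, (g c : E)⟫_ℂ = 0) ∧
      (∀ p : m × κ, ((b (Sum.inl p) : W) : E) = U p.1 (e p.2)) ∧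
      (∀ c, b (Sum.inr c) = g c) := by
  classical
  -- the complement `N` of the copies inside `W`, a closed subspace of the Hilbert space `W` (an intersection of kernels of `x ↦ ⟪U_i v, x⟫`)
  let N : Submodule ℂ W := ⨅ i : m, ⨅ v : V, LinearMap.ker (((innerSL ℂ (U i v)).comp W.subtypeL).toLinearMap)
  have hNmem : ∀ x : W, x ∈ N ↔ ∀ i v, ⟪U i v, (x : E)⟫_ℂ = 0 := fun x => by
    simp only [N, Submodule.mem_iInf, LinearMap.mem_ker, ContinuousLinearMap.coe_coe, ContinuousLinearMap.coe_comp, Function.comp_apply,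
      Submodule.subtypeL_apply, innerSL_apply_apply]
  have hNc : IsClosed (N : Set W) := by
    have hset : (N : Set W) = ⋂ i : m, ⋂ v : V, (LinearMap.ker (((innerSL ℂ (U i v)).comp W.subtypeL).toLinearMap) : Set W) := by
      simp only [N, Submodule.coe_iInf]
    rw [hset]
    exact isClosed_iInter fun i => isClosed_iInter fun v => ContinuousLinearMap.isClosed_ker _
  haveI : CompleteSpace N := hNc.completeSpace_coe
  obtain ⟨w₀, bN, hbN⟩ := exists_hilbertBasis ℂ N
  -- the assembled family
  let g : w₀ → W := fun c => ((bN c : N) : W)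
  let f : (m × κ) ⊕ w₀ → W := Sum.elim (fun p => ⟨U p.1 (e p.2), hUW p.1 _⟩) g
  have hf_inl : ∀ p : m × κ, ((f (Sum.inl p) : W) : E) = U p.1 (e p.2) := fun _ => rfl
  have hf_inr : ∀ c, f (Sum.inr c) = g c := fun _ => rfl
  have hg : ∀ c i v, ⟪U i v, (g c : E)⟫_ℂ = 0 := fun c => (hNmem _).1 (bN c).2
  -- orthonormality
  have hblock : Orthonormal ℂ fun p : m × κ => U p.1 (e p.2) := orthonormal_block e.orthonormal U hU
  have hon : Orthonormal ℂ f := by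
    rw [orthonormal_iff_ite]
    rintro (p | c) (p' | c')
    · rw [Submodule.coe_inner, hf_inl, hf_inl]
      simpa using orthonormal_iff_ite.1 hblock p p'
    · rw [if_neg (by simp), Submodule.coe_inner, hf_inl, hf_inr]
      exact hg c' p.1 (e p.2)
    · rw [if_neg (by simp), Submodule.coe_inner, hf_inr, hf_inl, ← inner_conj_symm, hg c p'.1 (e p'.2), map_zero]
    · rw [hf_inr, hf_inr, show ⟪g c, g c'⟫_ℂ = ⟪bN c, bN c'⟫_ℂ from (Submodule.coe_inner N (bN c) (bN c')).symm]
      simpa using orthonormal_iff_ite.1 bN.orthonormal c c'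
  -- completeness: a vector of `W` orthogonal to the family vanishes
  have hsep : ∀ x : W, (∀ k, ⟪f k, x⟫_ℂ = 0) → x = 0 := by
    intro x hx
    -- `x ⟂ U_i e_l` for all `(i, l)`, hence `U_i^* x = 0`, hence `x ⟂ range U_i`
    have hx0 : ∀ p : m × κ, ⟪U p.1 (e p.2), (x : E)⟫_ℂ = 0 := fun p => by
      rw [← hf_inl p, ← Submodule.coe_inner]
      exact hx (Sum.inl p)
    have hadj : ∀ i, ContinuousLinearMap.adjoint (U i).toContinuousLinearMap (x : E) = 0 := fun i => by
      have hrepr : ∀ l, e.repr (ContinuousLinearMap.adjoint (U i).toContinuousLinearMap (x : E)) l = 0 := fun l => by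
        rw [HilbertBasis.repr_apply_apply, ContinuousLinearMap.adjoint_inner_right]
        exact hx0 (i, l)
      have : e.repr (ContinuousLinearMap.adjoint (U i).toContinuousLinearMap (x : E)) = 0 := lp.ext (funext hrepr)
      exact (LinearIsometryEquiv.map_eq_zero_iff _).1 this
    have hxN : x ∈ N := (hNmem x).2 fun i v => by
      rw [← LinearIsometry.coe_toContinuousLinearMap, ← ContinuousLinearMap.adjoint_inner_right, hadj, inner_zero_right]
    -- and `x ⟂` the Hilbert basis `bN` of `N`
    have hcoef : ∀ c, ⟪bN c, (⟨x, hxN⟩ : N)⟫_ℂ = 0 := fun c => by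
      rw [Submodule.coe_inner]
      exact hx (Sum.inr c)
    have hx0' : (⟨x, hxN⟩ : N) = 0 := by
      have : bN.repr ⟨x, hxN⟩ = 0 := by
        ext c
        rw [HilbertBasis.repr_apply_apply, hcoef]
        rfl
      exact (LinearIsometryEquiv.map_eq_zero_iff _).1 this
    exact congrArg Subtype.val hx0'
  have hbot : (span ℂ (Set.range f))ᗮ = ⊥ := by
    rw [Submodule.eq_bot_iff]
    intro x hx
    exact hsep x fun k => (Submodule.mem_orthogonal _ x).1 hx (f k) (Submodule.subset_span ⟨k, rfl⟩)
  refine ⟨w₀, g, HilbertBasis.mkOfOrthogonalEqBot hon hbot, hg, fun p => ?_, fun c => ?_⟩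
  · rw [show (HilbertBasis.mkOfOrthogonalEqBot hon hbot (Sum.inl p) : W) = f (Sum.inl p) from
      congrFun (HilbertBasis.coe_mkOfOrthogonalEqBot hon hbot) (Sum.inl p), hf_inl]
  · exact (congrFun (HilbertBasis.coe_mkOfOrthogonalEqBot hon hbot) (Sum.inr c)).trans (hf_inr c)

/-! ## §3 Nuclearity of `C|_W` along the assembled basis -/

omit [CompleteSpace V] [CompleteSpace E] [DecidableEq m] in
/-- **`C|_W` is nuclear along the assembled basis**: `Σ_k ‖C (b_k)‖ < ∞` for the basis of ★ `exists_hilbertBasis_sum` — on the block vectors `‖C (U_j e_l)‖ ≤ (Σ_i |β_{ij}|) ‖T e_l‖`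
(summable by nuclearity of `T` along `e`), and on the complement `C = 0`. [cite: ReedSimon1972, Thm. VI.24] [cite: DeitmarEchterhoff2014, Lemma 9.2.7] -/
theorem summable_norm_apply_sum {W : Submodule ℂ E} {κ κ' : Type*} (e : HilbertBasis κ ℂ V)
    (U : m → (V →ₗᵢ[ℂ] E)) (T : V →L[ℂ] V) (he : Summable fun l => ‖T (e l)‖)
    (C : E →L[ℂ] E) (β : Matrix m m ℂ) (hC : ∀ j v, C (U j v) = ∑ i, β i j • U i (T v))
    (hC0 : ∀ w ∈ W, (∀ i v, ⟪U i v, w⟫_ℂ = 0) → C w = 0)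
    (g : κ' → W) (hg : ∀ c i v, ⟪U i v, (g c : E)⟫_ℂ = 0)
    (b : (m × κ) ⊕ κ' → W) (hb_inl : ∀ p : m × κ, ((b (Sum.inl p) : W) : E) = U p.1 (e p.2)) (hb_inr : ∀ c, b (Sum.inr c) = g c) :
    Summable fun k => ‖C ((b k : W) : E)‖ := by
  refine Summable.sum _ ?_ ?_
  · -- the block part: dominated by `(Σ_i |β_{ij}|) ‖T e_l‖`
    have hdom : ∀ p : m × κ, ‖C ((b (Sum.inl p) : W) : E)‖ ≤ (∑ i, ‖β i p.1‖) * ‖T (e p.2)‖ := fun p => by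
      rw [hb_inl]
      exact norm_apply_copy_le U T C β hC p.1 (e p.2)
    have hsum : Summable fun p : m × κ => (∑ i, ‖β i p.1‖) * ‖T (e p.2)‖ := by
      refine (summable_prod_of_nonneg fun p => mul_nonneg (Finset.sum_nonneg fun i _ => norm_nonneg _) (norm_nonneg _)).2
        ⟨fun j => ?_, ?_⟩
      · show Summable fun l => (∑ i, ‖β i j‖) * ‖T (e l)‖
        exact he.mul_left _
      · exact (hasSum_fintype _).summable
    exact Summable.of_nonneg_of_le (fun _ => norm_nonneg _) (fun p => hdom p) hsum
  · -- the complement part: `C (g c) = 0`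
    have h0 : ∀ c, ‖C ((b (Sum.inr c) : W) : E)‖ = 0 := fun c => by
      rw [hb_inr, hC0 _ (g c).2 (hg c), norm_zero]
    have : (fun k => ‖C ((b k : W) : E)‖) ∘ Sum.inr = fun _ => (0 : ℝ) := funext h0
    rw [this]
    exact summable_zero

/-! ## §4 The theorem -/

/-- **THE TRACE ON AN ISOTYPIC BLOCK, READ ALONG ANY HILBERT BASIS OF THE AMBIENT CLOSED SUBSPACE.**  `E`, `V` Hilbert spaces; `W ≤ E` closed; `U : m → (V →ₗᵢ E)` a finite family of
isometries with pairwise orthogonal ranges inside `W`; `T ∈ 𝓑(V)` NUCLEAR along a Hilbert basis `e` of `V` (`Σ_l ‖T e_l‖ < ∞`); `C ∈ 𝓑(E)` with `C (U_j v) = Σ_i β_{ij} U_i (T v)` and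
`C w = 0` for every `w ∈ W` orthogonal to all copies.  Then for EVERY Hilbert basis `b` of `W`: the diagonal `k ↦ ⟪b_k, C b_k⟫` is summable and
`Σ_k ⟪b_k, C b_k⟫ = tr(β) · Σ_l ⟪e_l, T e_l⟫`.  (The restricted operator `C|_W` is nuclear along the assembled basis §2–§3, hence its diagonal sum is basis-free on `W` — ★
`tsum_inner_apply_self_eq_of_summable_norm_apply` — and along the assembled basis it is the block sum ★ `hasSum_inner_apply_of_apply_eq_sum_smul` plus zero.)  This is
«`tr (A∘B)|_{π′} = Θ_τ(a) · tr β`» for `π′ ⊇ ⊕_i U_i(V) = π′^{K′}` WITHOUT any compactness of an ambient quotient. [cite: ReedSimon1972, Thm. VI.18 and Thm. VI.24]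
[cite: DeitmarEchterhoff2014, §7.3 Thm. 7.3.2 and Lemma 9.2.7] [cite: Gelbart1975, Lemma 10.6 (10.12)–(10.14)] [cite: BorelJacquet1979, §4.6] -/
theorem tsum_inner_apply_eq_trace_mul_of_summable_norm_apply (W : Submodule ℂ E) [CompleteSpace W] {κ ι : Type*} (e : HilbertBasis κ ℂ V)
    (U : m → (V →ₗᵢ[ℂ] E)) (hU : ∀ i j, i ≠ j → ∀ v w, ⟪U i v, U j w⟫_ℂ = 0) (hUW : ∀ i v, U i v ∈ W)
    (T : V →L[ℂ] V) (he : Summable fun l => ‖T (e l)‖)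
    (C : E →L[ℂ] E) (β : Matrix m m ℂ) (hC : ∀ j v, C (U j v) = ∑ i, β i j • U i (T v))
    (hC0 : ∀ w ∈ W, (∀ i v, ⟪U i v, w⟫_ℂ = 0) → C w = 0)
    (b : HilbertBasis ι ℂ W) :
    Summable (fun k => ⟪((b k : W) : E), C ((b k : W) : E)⟫_ℂ) ∧
      ∑' k, ⟪((b k : W) : E), C ((b k : W) : E)⟫_ℂ = β.trace * ∑' l, ⟪e l, T (e l)⟫_ℂ := by
  classical
  -- the restricted operator `C|_W : W →L W`
  have hCW : ∀ w : W, (C.comp W.subtypeL) w ∈ W := fun w => apply_mem_of_mem W U hU hUW T C β hC hC0 w.2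
  set CW : W →L[ℂ] W := (C.comp W.subtypeL).codRestrict W hCW with hCWdef
  have hCWapply : ∀ w : W, ((CW w : W) : E) = C (w : E) := fun w => by
    rw [hCWdef, ContinuousLinearMap.coe_codRestrict_apply]
    rfl
  have hinnerW : ∀ w : W, ⟪w, CW w⟫_ℂ = ⟪(w : E), C (w : E)⟫_ℂ := fun w => by
    rw [Submodule.coe_inner, hCWapply]
  -- the assembled basis and nuclearity of `C|_W` along it
  obtain ⟨κ', g, b₀, hg, hb₀_inl, hb₀_inr⟩ := exists_hilbertBasis_sum W e U hU hUW
  have hnuc : Summable fun k => ‖CW (b₀ k)‖ := by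
    have h := summable_norm_apply_sum e U T he C β hC hC0 g hg (fun k => b₀ k) hb₀_inl hb₀_inr
    refine h.congr fun k => ?_
    rw [← hCWapply]
    rfl
  -- basis-freeness on `W` (★ `NuclearAlongHilbertBasis`)
  have hfree : ∑' k, ⟪b k, CW (b k)⟫_ℂ = ∑' k, ⟪b₀ k, CW (b₀ k)⟫_ℂ :=
    tsum_inner_apply_self_eq_of_summable_norm_apply b₀ CW hnuc b
  have hsumm : Summable fun k => ⟪b k, CW (b k)⟫_ℂ := summable_inner_apply_self_of_summable_norm_apply b₀ CW hnuc b
  -- the block sum (★ H2 §1) and the vanishing complement sum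
  have hθ : HasSum (fun l => ⟪e l, T (e l)⟫_ℂ) (∑' l, ⟪e l, T (e l)⟫_ℂ) :=
    (summable_inner_apply_self_of_summable_norm_apply e T he e).hasSum
  have hblock : HasSum (fun p : m × κ => ⟪b₀ (Sum.inl p), CW (b₀ (Sum.inl p))⟫_ℂ) (β.trace * ∑' l, ⟪e l, T (e l)⟫_ℂ) := by
    have h := hasSum_inner_apply_of_apply_eq_sum_smul (fun l => e l) U hU T hθ C β hC
    refine h.congr_fun fun p => ?_
    rw [hinnerW, hb₀_inl]
  have hcompl : HasSum (fun c : κ' => ⟪b₀ (Sum.inr c), CW (b₀ (Sum.inr c))⟫_ℂ) 0 := by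
    have h0 : ∀ c, ⟪b₀ (Sum.inr c), CW (b₀ (Sum.inr c))⟫_ℂ = 0 := fun c => by
      rw [hinnerW, hb₀_inr, hC0 _ (g c).2 (hg c), inner_zero_right]
    simp_rw [h0]
    exact hasSum_zero
  have htot : HasSum (fun k => ⟪b₀ k, CW (b₀ k)⟫_ℂ) (β.trace * ∑' l, ⟪e l, T (e l)⟫_ℂ + 0) :=
    HasSum.sum (f := fun k => ⟪b₀ k, CW (b₀ k)⟫_ℂ) hblock hcompl
  rw [add_zero] at htot
  refine ⟨hsumm.congr fun k => hinnerW (b k), ?_⟩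
  calc ∑' k, ⟪((b k : W) : E), C ((b k : W) : E)⟫_ℂ = ∑' k, ⟪b k, CW (b k)⟫_ℂ := tsum_congr fun k => (hinnerW (b k)).symm
    _ = ∑' k, ⟪b₀ k, CW (b₀ k)⟫_ℂ := hfree
    _ = β.trace * ∑' l, ⟪e l, T (e l)⟫_ℂ := htot.tsum_eq

/-- **HasSum form** of ★ `tsum_inner_apply_eq_trace_mul_of_summable_norm_apply`. [cite: ReedSimon1972, Thm. VI.24] [cite: Gelbart1975, Lemma 10.6 (10.14)] -/
theorem hasSum_inner_apply_trace_mul_of_summable_norm_apply (W : Submodule ℂ E) [CompleteSpace W] {κ ι : Type*} (e : HilbertBasis κ ℂ V)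
    (U : m → (V →ₗᵢ[ℂ] E)) (hU : ∀ i j, i ≠ j → ∀ v w, ⟪U i v, U j w⟫_ℂ = 0) (hUW : ∀ i v, U i v ∈ W)
    (T : V →L[ℂ] V) (he : Summable fun l => ‖T (e l)‖)
    (C : E →L[ℂ] E) (β : Matrix m m ℂ) (hC : ∀ j v, C (U j v) = ∑ i, β i j • U i (T v))
    (hC0 : ∀ w ∈ W, (∀ i v, ⟪U i v, w⟫_ℂ = 0) → C w = 0)
    (b : HilbertBasis ι ℂ W) :
    HasSum (fun k => ⟪((b k : W) : E), C ((b k : W) : E)⟫_ℂ) (β.trace * ∑' l, ⟪e l, T (e l)⟫_ℂ) := by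
  obtain ⟨hs, ht⟩ := tsum_inner_apply_eq_trace_mul_of_summable_norm_apply W e U hU hUW T he C β hC hC0 b
  rw [← ht]
  exact hs.hasSum

end IsotypicBlock

end Literature.NumberTheory.Automorphic

end
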